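import Summits.ValiantsHypothesis.ValiantsHypothesis.Theorems.BarrierLeverPartitionMinorsHitByVPOfLowerSetsDoors

/-!
# Route BarrierLever — item `PartitionMinorsHitByVP` (stmt-ValiantsHypothesis-19717):
# the SEQUENTIAL (y-peelable) cross-unit door

Link file (`--supports stmt-ValiantsHypothesis-19717`; cell valiant-natproofs, rung V4, 𝒟-side door
(c); prover seat val-np-p1 gen 13). Definition-free. Closes NO item: it reduces item 19717 BY NAME to
the generic nonsingularity of ONE explicit matrix family on every (simplicial-complex) layout, a family
chosen so that an INDUCTIVE proof has a single step.

**The witness.** With `x_a = X (Fin.castAdd h a)`, `y_c = X (Fin.natAdd h c)`,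
```
  F(τ, φ, κ) = ∏_c ( 1 + y_c · Σ_a τ c a · x_a · ∏_b (1 + φ c a b · x_b) · ∏_d (1 + κ c a d · y_d) ).
```
Every factor has size `O(h²)`, so `L(F) ≤ 6h³ + 4h² + 3h`; its truncation to degree `2h`
(`AdditiveDoor.truncation_spec`) keeps every partition coefficient `x^S y^T` and lies in
`SmallCircuits ℂ (h+h) 7` for `h ≥ 2`.

**Why this shape (seat memo HOME/val-np-p1/g13/SEQUENTIAL-MEMO-valnp1-g13.md).** With
`κ c a d = 0` for `d ≥ c` the witness is `y`-PEELABLE: `F = G · (1 + y_{h-1} Δ_{h-1})` where `G` is the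
same witness on one `y`-variable less and `Δ_{h-1}` is a fresh generic factor. Hence «the generic member
hits every lower-set pair» follows by induction on the number of `y`-variables from ONE step lemma
(Y-STEP): if `g` hits every lower pair with column vertices in `y_{<k}`, then for generic `(τ, φ, κ)`
and all lower `R` (rows), `C₀ ⊇ C₁` (columns in `y_{<k}`) with `|R| = |C₀| + |C₁|`, the matrix
`[ g[R, C₀] | (g·Δ)[R, C₁] ]`, `Δ = Σ_a τ_a x_a e^{⟨φ_a,x⟩ + ⟨κ_a,y⟩}`, is nonsingular. The step is
PROVED (memo §4) whenever `R` has an up-set of size `|C₁|` with a system of distinct representative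
vertices (multilinearity of `det` in the per-vertex parameter groups; the monomial
`∏_T τ_{a(T)} κ_{a(T)}^T φ_{a(T)}^{S_T − a(T)}` has a unique source with coefficient
`± det g[R ∖ U, C₀] · g(0,0)^{|C₁|}`), in particular for `|C₁| ≤ 2` and for «wide» row complexes;
the remaining regime (`|C₁|` large against a deep row complex) is OPEN. Both twists are necessary:
with `φ = 0` the family dies on `({∅,x₂,x₃,x₂x₃}, {∅,y₁,y₂,y₃})`, with `κ = 0` on
`({∅,x₁,x₂,x₃}, {∅,y₂,y₃,y₂y₃})` (first-order-jet capacity, memo §3).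

**Evidence (seat numerics, exact mod 2⁶¹−1; scripts HOME/val-np-p1/g13/lab/).** The peelable family
(`κ c a d = 0` for `d ≥ c`) is order-dependent, so LABELLED lower pairs were tested: nonsingular on all
55 labelled pairs at `h = 3`, all 2 591 at `h = 4`, 30 000 random labelled pairs at `h = 5`, and on the
adversarial pairs «x-cube `2^[4]` versus y-Hamming ball of radius 2 in `[5]`» (`r = 16`) and its mirror.

**Results.**
* `complexity_colFactor_le`, `complexity_sequentialWitness_le` — size of the witness.
* `partitionMinor_hit_of_sequential` / `…_mem` — THE DOOR (explicit size; inside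
  `SmallCircuits ℂ (h+h) 7` for `h ≥ 2`).
* `partitionMinorsHitByVP_of_sequential` — arrow onto the route declaration (`b = 7`, `h₀ = 2`);
  `partitionMinorsHitByVP_of_sequential_lowerSets` — by the lower-set reduction
  (`DownCompression.partitionMinorsHitByVP_of_lowerSets`) the hypothesis is needed on simplicial-complex
  pairs only (`b = 11`).

WHAT THIS IS NOT: the hypothesis «det ≠ 0 for some `(τ, φ, κ)` on every lower-set layout» is an OPEN
conjecture (with the inductive reduction and the partial proof above); nothing is claimed about it,
about crux stmt-ValiantsHypothesis-14610, or about `VP` versus `VNP`.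
-/

set_option linter.dupNamespace false

namespace Summit.ValiantsHypothesis.ValiantsHypothesis.Theorems.BarrierLever.SequentialDoor

open Finset MvPolynomial
open Literature.Barriers.ValiantsHypothesis Literature.Computability.AlgebraicComplexity
open Summit.ValiantsHypothesis.ValiantsHypothesis.Theorems.BarrierLever.AdditiveDoor
  (complexity_one_add_C_mul_X_le complexity_rowFactor_le truncation_spec degree_partitionExpo_le)

noncomputable section

variable {h : ℕ}

/-! ## 1. Size of the witness -/

/-- An `x`-unit factor `∏_b (1 + C (t b) · x_b)` has size `≤ 3h`. -/
theorem complexity_colFactor_le (t : Fin h → ℂ) :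
    complexity (∏ b : Fin h, (1 + C (t b) * X (Fin.castAdd h b)) : MvPolynomial (Fin (h + h)) ℂ) ≤
      3 * h := by
  calc _ ≤ ∑ b : Fin h, complexity (1 + C (t b) * X (Fin.castAdd h b) : MvPolynomial (Fin (h + h)) ℂ) +
        (Finset.univ : Finset (Fin h)).card := complexity_finset_prod_le _ _
    _ ≤ ∑ _b : Fin h, 2 + (Finset.univ : Finset (Fin h)).card := by
        gcongr with b _; exact complexity_one_add_C_mul_X_le _ _
    _ = 3 * h := by simp; ring

/-- One cross term `C (τ c a) · x_a · (∏_b (1 + φ x_b)) · (∏_d (1 + κ y_d))` has size `≤ 6h + 3`. -/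
theorem complexity_crossTerm_le (t : ℂ) (a : Fin h) (φ κ : Fin h → ℂ) :
    complexity (C t * X (Fin.castAdd h a) *
        ((∏ b : Fin h, (1 + C (φ b) * X (Fin.castAdd h b))) *
          ∏ d : Fin h, (1 + C (κ d) * X (Fin.natAdd h d))) : MvPolynomial (Fin (h + h)) ℂ) ≤
      6 * h + 3 := by
  calc _ ≤ complexity (C t * X (Fin.castAdd h a) : MvPolynomial (Fin (h + h)) ℂ) +
        complexity ((∏ b : Fin h, (1 + C (φ b) * X (Fin.castAdd h b))) *
          ∏ d : Fin h, (1 + C (κ d) * X (Fin.natAdd h d)) : MvPolynomial (Fin (h + h)) ℂ) + 1 :=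
        complexity_mul_le_holds _ _
    _ ≤ (complexity (C t : MvPolynomial (Fin (h + h)) ℂ) +
          complexity (X (Fin.castAdd h a) : MvPolynomial (Fin (h + h)) ℂ) + 1) +
        (complexity (∏ b : Fin h, (1 + C (φ b) * X (Fin.castAdd h b)) : MvPolynomial (Fin (h + h)) ℂ) +
          complexity (∏ d : Fin h, (1 + C (κ d) * X (Fin.natAdd h d)) : MvPolynomial (Fin (h + h)) ℂ) +
            1) + 1 := by
        gcongr
        · exact complexity_mul_le_holds _ _
        · exact complexity_mul_le_holds _ _
    _ ≤ (0 + 0 + 1) + (3 * h + 3 * h + 1) + 1 := by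
        gcongr
        · exact (complexity_C_holds _).le
        · exact (complexity_X_holds _).le
        · exact complexity_colFactor_le _
        · exact complexity_rowFactor_le _
    _ = 6 * h + 3 := by ring

/-- One factor `1 + y_c · Σ_a (cross term)` has size `≤ 6h² + 4h + 2`. -/
theorem complexity_seqFactor_le (c : Fin h) (τ : Fin h → ℂ) (φ κ : Fin h → Fin h → ℂ) :
    complexity (1 + X (Fin.natAdd h c) * ∑ a : Fin h, C (τ a) * X (Fin.castAdd h a) *
        ((∏ b : Fin h, (1 + C (φ a b) * X (Fin.castAdd h b))) *
          ∏ d : Fin h, (1 + C (κ a d) * X (Fin.natAdd h d))) : MvPolynomial (Fin (h + h)) ℂ) ≤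
      6 * h * h + 4 * h + 2 := by
  have hsum : complexity (∑ a : Fin h, C (τ a) * X (Fin.castAdd h a) *
      ((∏ b : Fin h, (1 + C (φ a b) * X (Fin.castAdd h b))) *
        ∏ d : Fin h, (1 + C (κ a d) * X (Fin.natAdd h d))) : MvPolynomial (Fin (h + h)) ℂ) ≤
      6 * h * h + 4 * h := by
    calc _ ≤ ∑ a : Fin h, complexity (C (τ a) * X (Fin.castAdd h a) *
          ((∏ b : Fin h, (1 + C (φ a b) * X (Fin.castAdd h b))) *
            ∏ d : Fin h, (1 + C (κ a d) * X (Fin.natAdd h d))) : MvPolynomial (Fin (h + h)) ℂ) +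
          (Finset.univ : Finset (Fin h)).card := complexity_finset_sum_le _ _
      _ ≤ ∑ _a : Fin h, (6 * h + 3) + (Finset.univ : Finset (Fin h)).card := by
          gcongr with a _; exact complexity_crossTerm_le _ _ _ _
      _ = 6 * h * h + 4 * h := by simp; ring
  calc _ ≤ complexity (1 : MvPolynomial (Fin (h + h)) ℂ) +
        complexity (X (Fin.natAdd h c) * ∑ a : Fin h, C (τ a) * X (Fin.castAdd h a) *
          ((∏ b : Fin h, (1 + C (φ a b) * X (Fin.castAdd h b))) *
            ∏ d : Fin h, (1 + C (κ a d) * X (Fin.natAdd h d))) : MvPolynomial (Fin (h + h)) ℂ) + 1 :=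
        complexity_add_le_holds _ _
    _ ≤ 0 + (complexity (X (Fin.natAdd h c) : MvPolynomial (Fin (h + h)) ℂ) +
        complexity (∑ a : Fin h, C (τ a) * X (Fin.castAdd h a) *
          ((∏ b : Fin h, (1 + C (φ a b) * X (Fin.castAdd h b))) *
            ∏ d : Fin h, (1 + C (κ a d) * X (Fin.natAdd h d))) : MvPolynomial (Fin (h + h)) ℂ) + 1) +
        1 := by
        gcongr
        · rw [← C_1, complexity_C_holds]
        · exact complexity_mul_le_holds _ _
    _ ≤ 0 + (0 + (6 * h * h + 4 * h) + 1) + 1 := by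
        gcongr
        · exact (complexity_X_holds _).le
    _ = 6 * h * h + 4 * h + 2 := by ring

/-- **Size of the sequential witness**: `≤ 6h³ + 4h² + 3h`. -/
theorem complexity_sequentialWitness_le (τ : Fin h → Fin h → ℂ) (φ κ : Fin h → Fin h → Fin h → ℂ) :
    complexity (∏ c : Fin h, (1 + X (Fin.natAdd h c) * ∑ a : Fin h, C (τ c a) * X (Fin.castAdd h a) *
        ((∏ b : Fin h, (1 + C (φ c a b) * X (Fin.castAdd h b))) *
          ∏ d : Fin h, (1 + C (κ c a d) * X (Fin.natAdd h d)))) : MvPolynomial (Fin (h + h)) ℂ) ≤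
      6 * h * h * h + 4 * h * h + 3 * h := by
  calc _ ≤ ∑ c : Fin h, complexity (1 + X (Fin.natAdd h c) * ∑ a : Fin h, C (τ c a) * X (Fin.castAdd h a) *
          ((∏ b : Fin h, (1 + C (φ c a b) * X (Fin.castAdd h b))) *
            ∏ d : Fin h, (1 + C (κ c a d) * X (Fin.natAdd h d))) : MvPolynomial (Fin (h + h)) ℂ) +
        (Finset.univ : Finset (Fin h)).card := complexity_finset_prod_le _ _
    _ ≤ ∑ _c : Fin h, (6 * h * h + 4 * h + 2) + (Finset.univ : Finset (Fin h)).card := by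
        gcongr with c _; exact complexity_seqFactor_le _ _ _ _
    _ = 6 * h * h * h + 4 * h * h + 3 * h := by simp; ring

/-! ## 2. The door -/

/-- **THE SEQUENTIAL DOOR (explicit size).** If some parameters `(τ, φ, κ)` make the layout matrix
`[coeff_{x^{u i} y^{w j}} F(τ, φ, κ)]_{i,j}` of the sequential witness nonsingular, the layout `(u, w)` has
a nonsingular partition matrix at some `f` with `deg f ≤ 2h` and
`L(f) ≤ (2h+2)²(6h³ + 4h² + 3h) + 2h + 1`. -/
theorem partitionMinor_hit_of_sequential {ι : Type*} [Fintype ι] [DecidableEq ι] (h : ℕ)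
    (u w : ι → Finset (Fin h)) (τ : Fin h → Fin h → ℂ) (φ κ : Fin h → Fin h → Fin h → ℂ)
    (hdet : (Matrix.of fun i j : ι => MvPolynomial.coeff
      (∑ a ∈ u i, Finsupp.single (Fin.castAdd h a) 1 + ∑ c ∈ w j, Finsupp.single (Fin.natAdd h c) 1)
      (∏ c : Fin h, (1 + X (Fin.natAdd h c) * ∑ a : Fin h, C (τ c a) * X (Fin.castAdd h a) *
        ((∏ b : Fin h, (1 + C (φ c a b) * X (Fin.castAdd h b))) *
          ∏ d : Fin h, (1 + C (κ c a d) * X (Fin.natAdd h d)))) : MvPolynomial (Fin (h + h)) ℂ)).det ≠ 0) :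
    ∃ f : MvPolynomial (Fin (h + h)) ℂ, f.totalDegree ≤ h + h ∧
      complexity f ≤ (h + h + 2) ^ 2 * (6 * h * h * h + 4 * h * h + 3 * h) + (h + h + 1) ∧
      (Matrix.of fun i j : ι => MvPolynomial.coeff
        (∑ a ∈ u i, Finsupp.single (Fin.castAdd h a) 1 +
          ∑ c ∈ w j, Finsupp.single (Fin.natAdd h c) 1) f).det ≠ 0 := by
  set F : MvPolynomial (Fin (h + h)) ℂ :=
    ∏ c : Fin h, (1 + X (Fin.natAdd h c) * ∑ a : Fin h, C (τ c a) * X (Fin.castAdd h a) *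
      ((∏ b : Fin h, (1 + C (φ c a b) * X (Fin.castAdd h b))) *
        ∏ d : Fin h, (1 + C (κ c a d) * X (Fin.natAdd h d)))) with hF
  obtain ⟨hdeg, hcoeff, hsize⟩ := truncation_spec F (h + h)
  refine ⟨∑ e ∈ Finset.range (h + h + 1), homogeneousComponent e F, hdeg, ?_, ?_⟩
  · exact hsize.trans (by gcongr; exact complexity_sequentialWitness_le τ φ κ)
  · have hmat : (Matrix.of fun i j : ι => MvPolynomial.coeff
        (∑ a ∈ u i, Finsupp.single (Fin.castAdd h a) 1 +
          ∑ c ∈ w j, Finsupp.single (Fin.natAdd h c) 1)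
        (∑ e ∈ Finset.range (h + h + 1), homogeneousComponent e F)) =
        Matrix.of fun i j : ι => MvPolynomial.coeff
          (∑ a ∈ u i, Finsupp.single (Fin.castAdd h a) 1 +
            ∑ c ∈ w j, Finsupp.single (Fin.natAdd h c) 1) F := by
      ext i j
      rw [Matrix.of_apply, Matrix.of_apply, hcoeff _ (degree_partitionExpo_le _ _)]
    rw [hmat]
    exact hdet

/-- **THE SEQUENTIAL DOOR (class form).** For `h ≥ 2` the truncated sequential witness lies in
`SmallCircuits ℂ (h+h) 7`. -/
theorem partitionMinor_hit_of_sequential_mem {ι : Type*} [Fintype ι] [DecidableEq ι] (h : ℕ)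
    (hh : 2 ≤ h) (u w : ι → Finset (Fin h)) (τ : Fin h → Fin h → ℂ)
    (φ κ : Fin h → Fin h → Fin h → ℂ)
    (hdet : (Matrix.of fun i j : ι => MvPolynomial.coeff
      (∑ a ∈ u i, Finsupp.single (Fin.castAdd h a) 1 + ∑ c ∈ w j, Finsupp.single (Fin.natAdd h c) 1)
      (∏ c : Fin h, (1 + X (Fin.natAdd h c) * ∑ a : Fin h, C (τ c a) * X (Fin.castAdd h a) *
        ((∏ b : Fin h, (1 + C (φ c a b) * X (Fin.castAdd h b))) *
          ∏ d : Fin h, (1 + C (κ c a d) * X (Fin.natAdd h d)))) : MvPolynomial (Fin (h + h)) ℂ)).det ≠ 0) :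
    ∃ f ∈ SmallCircuits ℂ (h + h) 7,
      (Matrix.of fun i j : ι => MvPolynomial.coeff
        (∑ a ∈ u i, Finsupp.single (Fin.castAdd h a) 1 +
          ∑ c ∈ w j, Finsupp.single (Fin.natAdd h c) 1) f).det ≠ 0 := by
  obtain ⟨f, hdeg, hsize, hf⟩ := partitionMinor_hit_of_sequential h u w τ φ κ hdet
  refine ⟨f, ⟨hdeg, hsize.trans ?_⟩, hf⟩
  -- (2h+2)²(6h³+4h²+3h) + 2h + 1 ≤ (2h)^7 for h ≥ 2
  have e1 : (h + h + 2) ^ 2 ≤ 16 * (h * h) := by nlinarith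
  have e2 : 6 * h * h * h + 4 * h * h + 3 * h ≤ 13 * (h * h * h) := by nlinarith
  have e3 : h + h + 1 ≤ 3 * h := by omega
  have e4 : (h + h + 2) ^ 2 * (6 * h * h * h + 4 * h * h + 3 * h) + (h + h + 1) ≤
      208 * (h * h * h * h * h) + 3 * h := by
    calc _ ≤ 16 * (h * h) * (13 * (h * h * h)) + 3 * h := by gcongr
      _ = 208 * (h * h * h * h * h) + 3 * h := by ring
  have e5 : 208 * (h * h * h * h * h) + 3 * h ≤ (h + h) ^ 7 := by
    have h4 : 4 ≤ h * h := by nlinarith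
    have : (h + h) ^ 7 = 128 * (h * h) * (h * h * h * h * h) := by ring
    rw [this]
    nlinarith [Nat.zero_le (h * h * h * h * h), Nat.zero_le h]
  exact e4.trans e5

/-! ## 3. The links to item 19717 -/

/-- **The sequential door.** If for every `h ≥ 2` and every injective layout `(u, w)` SOME parameters
`(τ, φ, κ)` make the layout matrix of the sequential witness nonsingular, item 19717
`PartitionMinorsHitByVP` holds (`b = 7`, `h₀ = 2`). -/
theorem partitionMinorsHitByVP_of_sequential
    (hyp : ∀ h : ℕ, 2 ≤ h → ∀ (r : ℕ) (u w : Fin r → Finset (Fin h)),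
      Function.Injective u → Function.Injective w →
      ∃ (τ : Fin h → Fin h → ℂ) (φ κ : Fin h → Fin h → Fin h → ℂ),
        (Matrix.of fun i j : Fin r => MvPolynomial.coeff
          (∑ a ∈ u i, Finsupp.single (Fin.castAdd h a) 1 +
            ∑ c ∈ w j, Finsupp.single (Fin.natAdd h c) 1)
          (∏ c : Fin h, (1 + X (Fin.natAdd h c) * ∑ a : Fin h, C (τ c a) * X (Fin.castAdd h a) *
            ((∏ b : Fin h, (1 + C (φ c a b) * X (Fin.castAdd h b))) *
              ∏ d : Fin h, (1 + C (κ c a d) * X (Fin.natAdd h d)))) :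
            MvPolynomial (Fin (h + h)) ℂ)).det ≠ 0) :
    Summit.ValiantsHypothesis.ValiantsHypothesis.Theses.BarrierLever.PartitionMinorsHitByVP := by
  refine ⟨7, 2, fun h hh r u w hu hw => ?_⟩
  obtain ⟨τ, φ, κ, hdet⟩ := hyp h hh r u w hu hw
  exact partitionMinor_hit_of_sequential_mem h hh u w τ φ κ hdet

/-- **The sequential door on simplicial complexes.** By the lower-set reduction
(`DownCompression.partitionMinorsHitByVP_of_lowerSets`) the hypothesis is needed only for injective
layouts whose row family AND column family have lower-set ranges (`b = 11`). -/
theorem partitionMinorsHitByVP_of_sequential_lowerSets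
    (hyp : ∀ h : ℕ, 2 ≤ h → ∀ (r : ℕ) (u w : Fin r → Finset (Fin h)),
      Function.Injective u → Function.Injective w →
      IsLowerSet (Set.range u) → IsLowerSet (Set.range w) →
      ∃ (τ : Fin h → Fin h → ℂ) (φ κ : Fin h → Fin h → Fin h → ℂ),
        (Matrix.of fun i j : Fin r => MvPolynomial.coeff
          (∑ a ∈ u i, Finsupp.single (Fin.castAdd h a) 1 +
            ∑ c ∈ w j, Finsupp.single (Fin.natAdd h c) 1)
          (∏ c : Fin h, (1 + X (Fin.natAdd h c) * ∑ a : Fin h, C (τ c a) * X (Fin.castAdd h a) *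
            ((∏ b : Fin h, (1 + C (φ c a b) * X (Fin.castAdd h b))) *
              ∏ d : Fin h, (1 + C (κ c a d) * X (Fin.natAdd h d)))) :
            MvPolynomial (Fin (h + h)) ℂ)).det ≠ 0) :
    Summit.ValiantsHypothesis.ValiantsHypothesis.Theses.BarrierLever.PartitionMinorsHitByVP := by
  refine DownCompression.partitionMinorsHitByVP_of_lowerSets ⟨7, 2, fun h hh r u w hu hw hlu hlw => ?_⟩
  obtain ⟨τ, φ, κ, hdet⟩ := hyp h hh r u w hu hw hlu hlw
  exact partitionMinor_hit_of_sequential_mem h hh u w τ φ κ hdet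

end

end Summit.ValiantsHypothesis.ValiantsHypothesis.Theorems.BarrierLever.SequentialDoor
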